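import Summits.ResolutionOfSingularities.ResolutionOfSingularities.Theorems.ProximityCutClasses
import Mathlib.Algebra.Ring.GeomSum
import Mathlib.Algebra.CharP.Lemmas
import HarnessLib

/-!
# ProximityCutJets — finite jets at `A`-valued points and the ONE-STEP CONTRACTION LEMMA of the arc law
(lens-3 g24 node «ArcLaw», §8–§9; substrate of `ProximityCutArcLaw`, the kernel proof of the all-`e` arc law
`ProximityCut.NoFreePointTails` = route aside 33637 `MaxContactCut.PCArcLawPort`)

§8 JETS.  For a commutative `K`-algebra `A`, a point `δ : Fin 3 → A` and `G ∈ K[u₀,u₁,u₂]`: the Taylor expansion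
`taylorAt δ G = G(δ + v) ∈ A[v]`, its coefficients = the JET COEFFICIENTS `jetCoeff δ d G = (∂^{(d)}G)(δ)` (Hasse
derivatives of `Literature…HasseSchmidtDerivatives` evaluated at `δ`; `coeff_taylorAt`), the SCALED expansion
`coeff_{v^α} G(γ + η v) = η^{|α|} ∂^{(α)}G(γ)` (`coeff_aeval_scaled`), vanishing of monomials in constant-free quantities
below their degree, and the JET IDEAL `jetIdeal q δ G = ((∂^{(d)}G)(δ) : 0 < |d| < q)` = the image of the top-locus
ideal `TightDefectClasses.topIdeal q G` under evaluation at `δ` (`aeval_mem_jetIdeal`).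

§9 THE ONE-STEP CONTRACTION LEMMA `jet_contraction` (the engine of the arc law).  Let `σ : u_j ↦ u_j,
u_i ↦ u_j (u_i + b_i)` be the chart homomorphism of a move, `σ F = u_j^q (F' − h^q)` (`q = p^e`, `h^q` the cleaning,
`A` of characteristic `p`), `γ'` an `A`-valued point upstairs, `γ = σ(γ')` its image downstairs, `η = γ'_j`.  Then for
`0 < |α| < q`:  `η^{q−1} · (∂^{(α)}F)(γ) ∈ η^q · jetIdeal q γ' F'`.  Proof: push the chart identity through the Taylor map
at `γ'`; compose with the DENOMINATOR-FREE inverse `v_j ↦ η v_j, v_i ↦ (v_i − c_i v_j)·Σ_{m<q}(−v_j)^m` of the scaled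
Taylor substitution (exact modulo `v_j^q`: `(1 + v_j)·Σ(−v_j)^m = 1 − (−1)^q v_j^q`); below degree `q` the cleaning
`(…)^q` has no coefficients (`coeff_pow_char_pow_eq_zero`) and `(η + η v_j)^q = η^q (1 + v_j^q)`; compare the
coefficient of `v^α`.  No power series, no completion: everything is polynomial identities over `A`.
0 sorry; support definitions `taylorAt`, `jetCoeff`, `jetIdeal`.  (Sources: Hauser2010 Lecture IX (arcs through the
centres of a point-blowup sequence); CossartJannsenSaito2020 Cor. 5.37; the Hasse–Schmidt Taylor formalism of the tree.)
-/

open MvPolynomial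
open Literature.AlgebraicGeometry.Resolution

namespace Summit.ResolutionOfSingularities.ResolutionOfSingularities.Theorems.ProximityCut

/-! ## §8 JETS — Taylor coefficients of a polynomial at an `A`-valued point (g24 «ArcLaw») -/

section Jets

variable {K : Type} [Field K] {A : Type} [CommRing A] [Algebra K A]

/-- The Taylor expansion `G(δ + v)` of `G ∈ K[u₀,u₁,u₂]` at an `A`-valued point `δ` (variables `v = X`).
DEFINITION (support). -/
noncomputable def taylorAt (δ : Fin 3 → A) (G : MvPolynomial (Fin 3) K) : MvPolynomial (Fin 3) A :=
  aeval (fun i => (C (δ i) + X i : MvPolynomial (Fin 3) A)) G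

/-- The JET COEFFICIENT `∂^{(d)} G (δ)`: the Hasse derivative evaluated at the point.  DEFINITION (support). -/
noncomputable def jetCoeff (δ : Fin 3 → A) (d : Fin 3 →₀ ℕ) (G : MvPolynomial (Fin 3) K) : A :=
  aeval δ (hasseDeriv K d G)

/-- `taylorAt_eq_map_taylor`: Auxiliary step of this node's calculus, VERBATIM from the lens file (see the module docstring); the statement is its type. [folklore] -/
theorem taylorAt_eq_map_taylor (δ : Fin 3 → A) (G : MvPolynomial (Fin 3) K) :
    taylorAt δ G = MvPolynomial.map ((aeval δ).toRingHom) (taylor K G) := by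
  have key : (aeval (fun i => (C (δ i) + X i : MvPolynomial (Fin 3) A))).toRingHom =
      (MvPolynomial.map ((aeval δ).toRingHom)).comp (taylor K (σ := Fin 3)).toRingHom := by
    refine MvPolynomial.ringHom_ext (fun r => ?_) (fun i => ?_)
    · simp only [AlgHom.toRingHom_eq_coe, RingHom.coe_coe, aeval_C, RingHom.coe_comp, Function.comp_apply,
        taylor_C, map_C]
      rw [IsScalarTower.algebraMap_apply K A (MvPolynomial (Fin 3) A), MvPolynomial.algebraMap_eq]
    · simp
  exact RingHom.congr_fun key G

/-- `coeff_{v^d} G(δ + v) = ∂^{(d)}G(δ)`. [folklore] -/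
theorem coeff_taylorAt (δ : Fin 3 → A) (G : MvPolynomial (Fin 3) K) (d : Fin 3 →₀ ℕ) :
    coeff d (taylorAt δ G) = jetCoeff δ d G := by
  rw [taylorAt_eq_map_taylor, coeff_map, jetCoeff, hasseDeriv_apply]
  rfl

/-- The Taylor expansion as the sum of its jet coefficients. [folklore] -/
theorem taylorAt_eq_sum (δ : Fin 3 → A) (G : MvPolynomial (Fin 3) K) :
    taylorAt δ G = ∑ d ∈ (taylorAt δ G).support, monomial d (jetCoeff δ d G) := by
  conv_lhs => rw [(taylorAt δ G).as_sum]
  exact Finset.sum_congr rfl fun d _ => by rw [coeff_taylorAt]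

/-- SCALED Taylor expansion: `coeff_{v^α} G(γ + η v) = η^{|α|} ∂^{(α)}G(γ)`. [folklore] -/
theorem coeff_aeval_scaled (γ : Fin 3 → A) (η : A) (G : MvPolynomial (Fin 3) K) (α : Fin 3 →₀ ℕ) :
    coeff α (aeval (fun i => (C (γ i) + C η * X i : MvPolynomial (Fin 3) A)) G) =
      η ^ α.degree * jetCoeff γ α G := by
  classical
  set sc : MvPolynomial (Fin 3) A →ₐ[A] MvPolynomial (Fin 3) A := aeval fun i => C η * X i with hsc
  have hfun : (fun i => (C (γ i) + C η * X i : MvPolynomial (Fin 3) A)) =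
      fun i => (AlgHom.restrictScalars K sc) (C (γ i) + X i) := by
    funext i
    rw [AlgHom.restrictScalars_apply, hsc, map_add, aeval_C, aeval_X, MvPolynomial.algebraMap_eq]
  have hcomp : aeval (fun i => (C (γ i) + C η * X i : MvPolynomial (Fin 3) A)) G = sc (taylorAt γ G) := by
    rw [taylorAt, ← AlgHom.restrictScalars_apply K sc, comp_aeval_apply, ← hfun]
  have hmon : ∀ (d : Fin 3 →₀ ℕ) (t : A), sc (monomial d t) = monomial d (t * η ^ d.degree) := by
    intro d t
    rw [hsc, aeval_monomial, MvPolynomial.algebraMap_eq, monomial_eq, Finsupp.prod, Finsupp.prod,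
      Finsupp.degree_apply, C_mul, ← Finset.prod_pow_eq_pow_sum, map_prod C, mul_assoc,
      ← Finset.prod_mul_distrib]
    refine congrArg (C t * ·) (Finset.prod_congr rfl fun i _ => ?_)
    rw [mul_pow, ← map_pow]
  rw [hcomp, taylorAt_eq_sum, map_sum, coeff_sum]
  simp_rw [hmon, coeff_monomial]
  rw [Finset.sum_ite_eq']
  split_ifs with h
  · ring
  · rw [mem_support_iff, not_not, coeff_taylorAt] at h
    rw [h, mul_zero]

/-! ### Vanishing below a total degree (`∀ α, |α| < n → coeff α R = 0`) -/

omit [Algebra K A] in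
/-- A product of polynomials vanishing below total degrees `m` and `n` vanishes below `m + n`. [folklore] -/
theorem coeff_mul_eq_zero_of_degree_lt {m n : ℕ} {R S : MvPolynomial (Fin 3) A}
    (hR : ∀ α : Fin 3 →₀ ℕ, α.degree < m → coeff α R = 0) (hS : ∀ α : Fin 3 →₀ ℕ, α.degree < n → coeff α S = 0)
    {α : Fin 3 →₀ ℕ} (hα : α.degree < m + n) : coeff α (R * S) = 0 := by
  classical
  rw [coeff_mul]
  refine Finset.sum_eq_zero fun x hx => ?_
  have hx' : x.1 + x.2 = α := Finset.HasAntidiagonal.mem_antidiagonal.mp hx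
  have hdeg : x.1.degree + x.2.degree = α.degree := by rw [← map_add, hx']
  by_cases h1 : x.1.degree < m
  · rw [hR _ h1, zero_mul]
  · have h2 : x.2.degree < n := by omega
    rw [hS _ h2, mul_zero]

omit [Algebra K A] in
/-- The `k`-th power of a polynomial without constant term vanishes below total degree `k`. [folklore] -/
theorem coeff_pow_eq_zero_of_constantCoeff {R : MvPolynomial (Fin 3) A} (h : constantCoeff R = 0) :
    ∀ (k : ℕ) (α : Fin 3 →₀ ℕ), α.degree < k → coeff α (R ^ k) = 0 := by
  intro k
  induction k with
  | zero =>
    intro α hα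
    exact absurd hα (Nat.not_lt_zero _)
  | succ k ih =>
    intro α hα
    rw [pow_succ]
    refine coeff_mul_eq_zero_of_degree_lt ih (fun β hβ => ?_) hα
    have hβ0 : β = 0 := (Finsupp.degree_eq_zero_iff β).mp (by omega)
    rw [hβ0, ← constantCoeff_eq, h]

omit [Algebra K A] in
/-- `coeff_finset_prod_eq_zero`: Auxiliary step of this node's calculus, VERBATIM from the lens file (see the module docstring); the statement is its type. [folklore] -/
theorem coeff_finset_prod_eq_zero (θ : Fin 3 → MvPolynomial (Fin 3) A) (hθ : ∀ i, constantCoeff (θ i) = 0)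
    (d : Fin 3 → ℕ) (s : Finset (Fin 3)) :
    ∀ α : Fin 3 →₀ ℕ, α.degree < ∑ i ∈ s, d i → coeff α (∏ i ∈ s, θ i ^ d i) = 0 := by
  classical
  induction s using Finset.induction_on with
  | empty =>
    intro α hα
    rw [Finset.sum_empty] at hα
    exact absurd hα (Nat.not_lt_zero _)
  | insert i s hi ih =>
    intro α hα
    rw [Finset.prod_insert hi]
    rw [Finset.sum_insert hi] at hα
    exact coeff_mul_eq_zero_of_degree_lt (coeff_pow_eq_zero_of_constantCoeff (hθ i) (d i)) ih hα

omit [Algebra K A] in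
/-- A monomial in quantities without constant term vanishes below its total degree. [folklore] -/
theorem coeff_prod_pow_eq_zero (θ : Fin 3 → MvPolynomial (Fin 3) A) (hθ : ∀ i, constantCoeff (θ i) = 0)
    (d : Fin 3 →₀ ℕ) {α : Fin 3 →₀ ℕ} (hα : α.degree < d.degree) :
    coeff α (d.prod fun i k => θ i ^ k) = 0 := by
  rw [Finsupp.degree_apply] at hα
  rw [Finsupp.prod]
  exact coeff_finset_prod_eq_zero θ hθ d d.support α hα

omit [Algebra K A] in
/-- Multiples of `v_j^q` have no coefficient of `v_j`-degree `< q`. [folklore] -/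
theorem coeff_eq_zero_of_mem_span_X_pow {j : Fin 3} {q : ℕ} {R : MvPolynomial (Fin 3) A}
    (hR : R ∈ Ideal.span {(X j : MvPolynomial (Fin 3) A) ^ q}) {α : Fin 3 →₀ ℕ} (hα : α j < q) :
    coeff α R = 0 := by
  classical
  obtain ⟨w, rfl⟩ := Ideal.mem_span_singleton'.mp hR
  rw [X_pow_eq_monomial, coeff_mul_monomial', if_neg]
  intro hle
  have := hle j
  rw [Finsupp.single_eq_same] at this
  omega

/-- Substitutions that agree modulo an ideal agree modulo it on every polynomial. [folklore] -/
theorem aeval_sub_aeval_mem_ideal (I : Ideal (MvPolynomial (Fin 3) A)) {f g : Fin 3 → MvPolynomial (Fin 3) A}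
    (h : ∀ i, f i - g i ∈ I) (G : MvPolynomial (Fin 3) K) : aeval f G - aeval g G ∈ I := by
  induction G using MvPolynomial.induction_on with
  | C r => rw [aeval_C, aeval_C, sub_self]; exact I.zero_mem
  | add P Q hP hQ => rw [map_add, map_add, add_sub_add_comm]; exact I.add_mem hP hQ
  | mul_X P i hP =>
    rw [map_mul, map_mul, aeval_X, aeval_X,
      show aeval f P * f i - aeval g P * g i = (aeval f P - aeval g P) * f i + aeval g P * (f i - g i) by ring]
    exact I.add_mem (I.mul_mem_right _ hP) (I.mul_mem_left _ (h i))

/-- The JET IDEAL `(∂^{(d)}G(δ) : 0 < |d| < q)`: the image of the top-locus ideal `topIdeal q G` under evaluation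
at `δ`.  DEFINITION (support). -/
def jetIdeal (q : ℕ) (δ : Fin 3 → A) (G : MvPolynomial (Fin 3) K) : Ideal A :=
  Ideal.span ((fun d => jetCoeff δ d G) '' {d : Fin 3 →₀ ℕ | d ≠ 0 ∧ d.degree < q})

/-- Evaluation maps the top-locus ideal into the jet ideal. [folklore] -/
theorem aeval_mem_jetIdeal {q : ℕ} (δ : Fin 3 → A) {G x : MvPolynomial (Fin 3) K}
    (hx : x ∈ TightDefectClasses.topIdeal q G) : aeval δ x ∈ jetIdeal q δ G := by
  have h := Ideal.mem_map_of_mem (aeval δ).toRingHom hx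
  rw [TightDefectClasses.topIdeal, Ideal.map_span, ← Set.image_comp] at h
  exact h

end Jets

/-! ## §9 THE ONE-STEP CONTRACTION LEMMA (g24 «ArcLaw») -/

section OneStep

variable {K : Type} [Field K] {A : Type} [CommRing A] [Algebra K A]
  (p : ℕ) [Fact p.Prime] [CharP A p]

/-- **ONE-STEP CONTRACTION (PROVED).**  Let `σ : u_j ↦ u_j, u_i ↦ u_j (u_i + b_i)` be the chart homomorphism of a
move, `σ F = u_j^q (F' − h^q)` (`q = p^e`; `h^q` = the cleaning), `γ'` an `A`-valued point upstairs, `γ = σ(γ')` its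
image downstairs and `η := γ'_j`.  Then for every `0 < |α| < q`:
`η^{q−1} · ∂^{(α)}F(γ) ∈ η^q · (∂^{(d)}F'(γ') : 0 < |d| < q)`.
Mechanism: push the chart identity through the Taylor map at `γ'`, apply the denominator-free inverse
`v_j ↦ η v_j, v_i ↦ (v_i − c_i v_j) Σ_{m<q} (−v_j)^m` of the SCALED Taylor substitution (exact modulo `v_j^q`), and
compare coefficients below degree `q` (the cleaning `h^q` and the factor `(η + v_j)^q = η^q + v_j^q` are invisible
there). [new] -/
theorem jet_contraction (e : ℕ) (j : Fin 3) (b : Fin 3 → K) {F F' h : MvPolynomial (Fin 3) K}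
    (hchart : aeval (fun i => if i = j then (X j : MvPolynomial (Fin 3) K) else X j * (X i + C (b i))) F =
      X j ^ p ^ e * (F' - h ^ p ^ e))
    (γ' γ : Fin 3 → A) (hγj : γ j = γ' j) (hγi : ∀ i, i ≠ j → γ i = γ' j * (γ' i + algebraMap K A (b i)))
    {α : Fin 3 →₀ ℕ} (hα0 : α ≠ 0) (hα : α.degree < p ^ e) :
    γ' j ^ (p ^ e - 1) * jetCoeff γ α F ∈ Ideal.span {γ' j ^ p ^ e} * jetIdeal (p ^ e) γ' F' := by
  classical
  have hαq : α.degree ≤ p ^ e - 1 := Nat.le_sub_one_of_lt hα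
  have hαj : α j < p ^ e := lt_of_le_of_lt (Finsupp.le_degree j α) hα
  -- Ψ = the Taylor map at γ'
  set Ψ : MvPolynomial (Fin 3) K →ₐ[K] MvPolynomial (Fin 3) A :=
    aeval fun i => (C (γ' i) + X i : MvPolynomial (Fin 3) A) with hΨ
  have hΨC : ∀ r : K, Ψ (C r) = C (algebraMap K A r) := fun r => by
    rw [hΨ, aeval_C, IsScalarTower.algebraMap_apply K A (MvPolynomial (Fin 3) A), MvPolynomial.algebraMap_eq]
  have hΨX : ∀ i, Ψ (X i) = C (γ' i) + X i := fun i => by rw [hΨ, aeval_X]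
  -- Θ = the denominator-free inverse of the scaled Taylor substitution (exact modulo `v_j^q`)
  set gq : MvPolynomial (Fin 3) A := ∑ m ∈ Finset.range (p ^ e), (-X j) ^ m with hgq
  have hgeom : (1 + X j) * gq = 1 - (-1) ^ p ^ e * X j ^ p ^ e := by
    have h1 := mul_neg_geom_sum (-(X j : MvPolynomial (Fin 3) A)) (p ^ e)
    rw [sub_neg_eq_add, neg_pow] at h1
    rw [hgq, h1]
  set θv : Fin 3 → MvPolynomial (Fin 3) A := fun i =>
    if i = j then C (γ' j) * X j else (X i - (C (γ' i) + C (algebraMap K A (b i))) * X j) * gq with hθv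
  set Θ : MvPolynomial (Fin 3) A →ₐ[A] MvPolynomial (Fin 3) A := aeval θv with hΘ
  have hΘC : ∀ a : A, Θ (C a) = C a := fun a => by rw [hΘ, aeval_C, MvPolynomial.algebraMap_eq]
  have hΘXj : Θ (X j) = C (γ' j) * X j := by
    rw [hΘ, aeval_X, hθv]
    exact if_pos rfl
  have hΘXi : ∀ i, i ≠ j → Θ (X i) = (X i - (C (γ' i) + C (algebraMap K A (b i))) * X j) * gq :=
    fun i hi => by
      rw [hΘ, aeval_X, hθv]
      exact if_neg hi
  have hθv0 : ∀ i, constantCoeff (θv i) = 0 := by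
    intro i
    by_cases hi : i = j
    · rw [show θv i = C (γ' j) * X j from if_pos hi, map_mul, constantCoeff_X, mul_zero]
    · rw [show θv i = (X i - (C (γ' i) + C (algebraMap K A (b i))) * X j) * gq from if_neg hi, map_mul, map_sub,
        map_mul, constantCoeff_X, constantCoeff_X, mul_zero, sub_zero, zero_mul]
  -- the composite substitution `Φ = Θ ∘ Ψ` and its values on the chart images of the variables
  set Φ : MvPolynomial (Fin 3) K →ₐ[K] MvPolynomial (Fin 3) A := (Θ.restrictScalars K).comp Ψ with hΦ
  have hΦ' : ∀ x, Φ x = Θ (Ψ x) := fun x => rfl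
  have hWj : Φ (X j) = C (γ j) + C (γ' j) * X j := by
    rw [hΦ', hΨX, map_add, hΘC, hΘXj, hγj]
  have hWi : ∀ i, i ≠ j → Φ (X j * (X i + C (b i))) = C (γ i) + C (γ' j) * X i +
      X j ^ p ^ e * (-(C (γ' j) * (X i - (C (γ' i) + C (algebraMap K A (b i))) * X j) * (-1) ^ p ^ e)) := by
    intro i hi
    simp only [hΦ', map_mul, map_add, hΨX, hΨC, hΘC, hΘXj, hΘXi i hi, hγi i hi]
    linear_combination (C (γ' j) * (X i - (C (γ' i) + C (algebraMap K A (b i))) * X j)) * hgeom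
  -- push the chart identity through Φ
  have H : Φ (aeval (fun i => if i = j then (X j : MvPolynomial (Fin 3) K) else X j * (X i + C (b i))) F) =
      Φ (X j) ^ p ^ e * (Φ F' - Φ h ^ p ^ e) := by
    rw [hchart, map_mul, map_pow, map_sub, map_pow]
  rw [comp_aeval_apply] at H
  -- the substituted point agrees with the SCALED Taylor point `γ + γ'_j · v` modulo `v_j^q`
  have hD : aeval (fun i => Φ (if i = j then (X j : MvPolynomial (Fin 3) K) else X j * (X i + C (b i)))) F -
      aeval (fun i => (C (γ i) + C (γ' j) * X i : MvPolynomial (Fin 3) A)) F ∈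
      Ideal.span {(X j : MvPolynomial (Fin 3) A) ^ p ^ e} := by
    refine aeval_sub_aeval_mem_ideal _ (fun i => ?_) F
    by_cases hi : i = j
    · subst hi
      rw [if_pos rfl, hWj, sub_self]
      exact Ideal.zero_mem _
    · rw [if_neg hi, hWi i hi, add_sub_cancel_left]
      exact Ideal.mul_mem_right _ _ (Ideal.mem_span_singleton_self _)
  -- coefficient of `v^α`: of the scaled Taylor expansion …
  have e1 : coeff α (aeval (fun i => (C (γ i) + C (γ' j) * X i : MvPolynomial (Fin 3) A)) F) =
      γ' j ^ α.degree * jetCoeff γ α F := coeff_aeval_scaled γ (γ' j) F α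
  -- … of the exceptional factor times the upstairs expansion …
  have hfac : Φ (X j) ^ p ^ e = C (γ' j ^ p ^ e) * (1 + X j ^ p ^ e) := by
    rw [hWj, hγj, show (C (γ' j) + C (γ' j) * X j : MvPolynomial (Fin 3) A) = C (γ' j) * (1 + X j) by ring,
      mul_pow, ← map_pow, add_pow_char_pow _ _ p e, one_pow]
  have e3 : coeff α (Φ (X j) ^ p ^ e * (Φ F' - Φ h ^ p ^ e)) =
      γ' j ^ p ^ e * (coeff α (Φ F') - coeff α (Φ h ^ p ^ e)) := by
    rw [hfac, show C (γ' j ^ p ^ e) * (1 + X j ^ p ^ e) * (Φ F' - Φ h ^ p ^ e) =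
      C (γ' j ^ p ^ e) * (Φ F' - Φ h ^ p ^ e) + X j ^ p ^ e * (C (γ' j ^ p ^ e) * (Φ F' - Φ h ^ p ^ e)) by ring,
      coeff_add, coeff_C_mul, coeff_sub,
      coeff_eq_zero_of_mem_span_X_pow (Ideal.mul_mem_right _ _ (Ideal.mem_span_singleton_self _)) hαj, add_zero]
  -- … the cleaning is invisible below degree `q` …
  have e4 : coeff α (Φ h ^ p ^ e) = 0 := by
    obtain ⟨i, hi⟩ : ∃ i, α i ≠ 0 := by
      by_contra hcon
      push Not at hcon
      exact hα0 (Finsupp.ext hcon)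
    have hiq : ¬ p ^ e ∣ α i := fun hdvd =>
      hi (Nat.eq_zero_of_dvd_of_lt hdvd (lt_of_le_of_lt (Finsupp.le_degree i α) hα))
    exact coeff_pow_char_pow_eq_zero p e (Φ h) α i hiq
  -- … and the upstairs expansion contributes jet coefficients of `F'` of orders `0 < |d| < q` only
  have e5 : coeff α (Φ F') ∈ jetIdeal (p ^ e) γ' F' := by
    have hF' : Φ F' = Θ (taylorAt γ' F') := rfl
    rw [hF', taylorAt_eq_sum, map_sum, coeff_sum]
    refine Ideal.sum_mem _ fun d _ => ?_
    rw [hΘ, aeval_monomial, MvPolynomial.algebraMap_eq, coeff_C_mul]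
    by_cases hd0 : d = 0
    · rw [hd0, Finsupp.prod_zero_index, coeff_one, if_neg (Ne.symm hα0), mul_zero]
      exact Ideal.zero_mem _
    by_cases hdq : p ^ e ≤ d.degree
    · rw [coeff_prod_pow_eq_zero θv hθv0 d (lt_of_lt_of_le hα hdq), mul_zero]
      exact Ideal.zero_mem _
    · exact Ideal.mul_mem_right _ _ (Ideal.subset_span ⟨d, ⟨hd0, not_le.mp hdq⟩, rfl⟩)
  -- assemble
  have key : γ' j ^ α.degree * jetCoeff γ α F = γ' j ^ p ^ e * coeff α (Φ F') := by
    have hcoeffD := coeff_eq_zero_of_mem_span_X_pow hD hαj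
    rw [coeff_sub, H, e3, e4, e1, sub_zero] at hcoeffD
    linear_combination -hcoeffD
  have hmem : γ' j ^ α.degree * jetCoeff γ α F ∈ Ideal.span {γ' j ^ p ^ e} * jetIdeal (p ^ e) γ' F' := by
    rw [key]
    exact Ideal.mul_mem_mul (Ideal.mem_span_singleton_self _) e5
  have hsplit : γ' j ^ (p ^ e - 1) = γ' j ^ (p ^ e - 1 - α.degree) * γ' j ^ α.degree := by
    rw [← pow_add, Nat.sub_add_cancel hαq]
  rw [hsplit, mul_assoc]
  exact Ideal.mul_mem_left _ _ hmem

end OneStep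

end Summit.ResolutionOfSingularities.ResolutionOfSingularities.Theorems.ProximityCut
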